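import Mathlib.RingTheory.Valuation.Basic
import Mathlib.RingTheory.RootsOfUnity.PrimitiveRoots
import Mathlib.GroupTheory.ArchimedeanDensely
import Mathlib.Tactic.LinearCombination
import Mathlib.Tactic.Ring
import HarnessLib

/-!
# X11b at `p = 3` (team N8/O2), S28-b (P2′): the two field hypotheses of the Kummer intersection
# lemma from a `ℤ`-valued valuation with `v(3) = 1` — no primitive cube root of unity, and
# `a ≡ 1 (mod 3)`, `a ≢ 1 (mod 9)` is not a cube

HONEST FRAMING (cell `b2b-bsdres`, run/shared/lean/b2b/bsd-rank1-residual/, verbatim in every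
file): the goal of the cell is to DELETE the COMBINATION-SHAPED residual classes of the
Birch–Swinnerton-Dyer formula for ALL analytic-rank `≤ 1` elliptic curves over `ℚ` — "full BSD
formula for every rank `≤ 1` curve in class `C`" assembled STRICTLY from published theorems — so
that the rank-`≤ 1` remainder becomes exactly the CONSTRUCTION-SHAPED classes, which are TYPED
(missing-input `Prop`s), NOT attempted. This is not "finishing BSD". Team N8/O2 = `x11b3`, seat
`b2b-bsdres-x11b3-p4` (lead GEN 7 R8-18, S28-b; S28 is a READING of `Three.HsiehDescentAt₃` —
H45: nothing shrinks). THEOREMS ONLY: no definition, no named fact, no `sorry`; nothing is booked.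

## What

`KummerRadicalIntersection.lean` (p264085, piece (P1)) proves `K⟮x⟯ ⊓ K⟮ζ x⟯ = ⊥` for
`x^{3^k} = a` under two hypotheses on the base field `K`: (h_a) `a` is not a cube in `K`, (h_ζ)
`K` contains no primitive cube root of unity. For Castella's `𝔎 = Frac R₀ ⊂ ℂ₃` (`R₀ =
unrIntegers 3`, the completed maximal UNRAMIFIED extension of `ℚ₃`) both come from the discrete
valuation (r2's S28-K1-CHECK §4 (D1)/(D2): "the discreteness of `𝔎` is exactly the lever"). This
file proves them for ANY field `K` carrying a valuation `v : Valuation K ℤᵐ⁰` with `v 3 = exp(−1)`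
(i.e. `3` is a uniformiser — unramified over `ℚ₃` — or, for (h_a), just `v 3 ≤ exp(−1)`):

* `valuation_eq_one_of_pow_eq_one` — `z ^ n = 1`, `n ≠ 0` ⇒ `v z = 1`;
* **`eq_one_of_pow_three_eq_one`** (h_ζ): `z³ = 1 ⇒ z = 1` — otherwise `(z − 1)² = −3z` has
  valuation `exp(−1)`, which is not a square in `ℤᵐ⁰`;
* **`pow_three_ne_of_valuation_sub_one`** (h_a): if `v (a − 1) = exp(−1)` (`a ∈ 1 + 3R ∖ 1 + 9R`)
  then `b³ ≠ a` for every `b ∈ K` — with `β = b − 1`, `a − 1 = β³ + 3β² + 3β` has valuation `1`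
  if `β` is a unit and `≤ exp(−2)` if `v β ≤ exp(−1)`.

So the only input of S28-b left outside the kernel is the EXISTENCE of such a valuation on
`Frac (unrIntegers 3)` with valuation ring `unrIntegers 3` (piece (P2) of `S28b-SCOPE.md`; a
Mathlib gap — candidate for ONE labelled hypothesis of the S28 glue, lead's call).

References (locators only; no new fact): [cite: SerreLocalFields1979, II §3, IV §4 (ramification of
`ℚ_p(ζ_p)`)].

## Design

No definitions; `K` any field, `v : Valuation K ℤᵐ⁰`; `WithZero.exp` / `WithZero.log`
bookkeeping. Axioms: `propext`, `Classical.choice`, `Quot.sound`.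
-/

open WithZero

namespace Summit.BirchSwinnertonDyer.Rank1Residual.X11b.KummerRadical

variable {K : Type*} [Field K] (v : Valuation K ℤᵐ⁰)

/-- A root of unity has valuation `1`. [folklore] -/
theorem valuation_eq_one_of_pow_eq_one {z : K} {n : ℕ} (hn : n ≠ 0) (hz : z ^ n = 1) : v z = 1 := by
  have hz0 : z ≠ 0 := by
    rintro rfl
    rw [zero_pow hn] at hz
    exact zero_ne_one hz
  have hv0 : v z ≠ 0 := (Valuation.ne_zero_iff v).mpr hz0
  have h : v z ^ n = 1 := by rw [← map_pow, hz, map_one]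
  have hlog : (n : ℤ) * log (v z) = 0 := by
    have := congrArg log h
    rwa [log_pow, log_one, nsmul_eq_mul] at this
  have hlog0 : log (v z) = 0 := by
    rcases mul_eq_zero.mp hlog with h | h
    · exact absurd h (by exact_mod_cast hn)
    · exact h
  rw [← exp_log hv0, hlog0, exp_zero]

/-- **(h_ζ) An unramified-type valued field has no primitive cube root of unity**: if
`v 3 = exp(−1)` (`3` a uniformiser) then `z³ = 1 ⇒ z = 1`. Indeed for `z ≠ 1`, `z² + z + 1 = 0`
gives `(z − 1)² = −3z` of valuation `exp(−1)` — not a square. (Serre, *Local Fields* IV §4: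
`ℚ₃(ζ₃)/ℚ₃` is ramified.) [cite: SerreLocalFields1979, IV §4] -/
theorem eq_one_of_pow_three_eq_one (hv3 : v 3 = exp (-1)) (z : K) (hz : z ^ 3 = 1) : z = 1 := by
  by_contra hz1
  have hfac : (z - 1) * (z ^ 2 + z + 1) = 0 := by linear_combination hz
  have h2 : z ^ 2 + z + 1 = 0 := by
    rcases mul_eq_zero.mp hfac with h | h
    · exact absurd (sub_eq_zero.mp h) hz1
    · exact h
  have h3 : (z - 1) ^ 2 = -3 * z := by linear_combination h2
  have hvz : v z = 1 := valuation_eq_one_of_pow_eq_one v three_ne_zero hz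
  have hv : v (z - 1) ^ 2 = exp (-1) := by
    rw [← map_pow, h3, map_mul, Valuation.map_neg, hv3, hvz, mul_one]
  have hne : v (z - 1) ≠ 0 := (Valuation.ne_zero_iff v).mpr (sub_ne_zero.mpr hz1)
  have hlog := congrArg log hv
  rw [log_pow, log_exp, nsmul_eq_mul] at hlog
  omega

/-- **(h_a) `a ∈ 1 + 3R ∖ 1 + 9R` is not a cube**: for a `ℤ`-valued valuation with
`v 3 ≤ exp(−1)` (residue characteristic `3`) and `v (a − 1) = exp(−1)`, no `b ∈ K` has `b³ = a`.
Writing `β = b − 1`: `a − 1 = β³ + 3β² + 3β`; if `β` is a unit the right-hand side is a unit, and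
if `v β ≤ exp(−1)` it has valuation `≤ exp(−2)` — either way not `exp(−1)`. (r2, S28-K1-CHECK §4
(D1): "the discreteness of `𝔎` is exactly the lever"; in `ℂ₃` itself `a` IS a cube.) [folklore] -/
theorem pow_three_ne_of_valuation_sub_one (hv3 : v 3 ≤ exp (-1)) {a : K}
    (ha : v (a - 1) = exp (-1)) (b : K) : b ^ 3 ≠ a := by
  intro hb
  have hlt1 : exp (-1 : ℤ) < 1 := by rw [← exp_zero, exp_lt_exp]; norm_num
  set β : K := b - 1 with hβ
  have hkey : a - 1 = β * (β ^ 2 + 3 * β + 3) := by rw [← hb, hβ]; ring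
  by_cases hβ1 : v β = 1
  · -- `β` a unit: `a - 1` is a unit
    have hsmall : v (3 * β + 3) < v (β ^ 2) := by
      rw [map_pow, hβ1, one_pow]
      refine lt_of_le_of_lt (v.map_add _ _) (max_lt ?_ (lt_of_le_of_lt hv3 hlt1))
      rw [map_mul, hβ1, mul_one]
      exact lt_of_le_of_lt hv3 hlt1
    have hsum : v (β ^ 2 + (3 * β + 3)) = v (β ^ 2) := Valuation.map_add_eq_of_lt_left v hsmall
    have : v (a - 1) = 1 := by
      rw [hkey, map_mul, hβ1, one_mul, show β ^ 2 + 3 * β + 3 = β ^ 2 + (3 * β + 3) by ring, hsum,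
        map_pow, hβ1, one_pow]
    rw [this] at ha
    exact absurd ha.symm (ne_of_lt hlt1)
  · -- `v β < 1`, hence `≤ exp (-1)`; then `v (a - 1) ≤ exp (-2)`
    have hb1 : v b = 1 := by
      have hva : v a = 1 := by
        -- `v (a - 1) < 1 = v 1` (tree: `Mazur1978.v_eq_one_of_v_sub_one_lt`, not imported here)
        have h := Valuation.map_add_eq_of_lt_left v (x := 1) (y := a - 1)
          (by rw [map_one, ha]; exact hlt1)
        rwa [map_one, add_sub_cancel] at h
      have h : v b ^ 3 = 1 := by rw [← map_pow, hb, hva]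
      have hb0 : b ≠ 0 := by
        rintro rfl
        rw [map_zero, zero_pow three_ne_zero] at h
        exact zero_ne_one h
      have hne : v b ≠ 0 := (Valuation.ne_zero_iff v).mpr hb0
      have hlog := congrArg log h
      rw [log_pow, log_one, nsmul_eq_mul] at hlog
      rw [← exp_log hne, show log (v b) = 0 by omega, exp_zero]
    have hβle : v β ≤ 1 := by
      rw [hβ]
      refine le_trans (Valuation.map_sub v b 1) ?_
      rw [hb1, map_one, max_self]
    have hβlt : v β < 1 := lt_of_le_of_ne hβle hβ1
    have hβle' : v β ≤ exp (-1) := by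
      by_cases hβ0 : v β = 0
      · rw [hβ0]; exact zero_le
      · rw [← exp_log hβ0, exp_le_exp]
        have : log (v β) < 0 := by
          rw [← exp_log hβ0, ← exp_zero, exp_lt_exp] at hβlt; exact hβlt
        omega
    have h1 : v (β ^ 3) ≤ exp (-2) := by
      rw [map_pow]
      calc v β ^ 3 ≤ exp (-1) ^ 3 := pow_le_pow_left' hβle' 3
        _ = exp (-3) := by rw [← exp_nsmul]; norm_num
        _ ≤ exp (-2) := by rw [exp_le_exp]; norm_num
    have h2 : v (3 * β ^ 2) ≤ exp (-2) := by
      rw [map_mul, map_pow]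
      calc v 3 * v β ^ 2 ≤ exp (-1) * exp (-1) ^ 2 :=
            mul_le_mul' hv3 (pow_le_pow_left' hβle' 2)
        _ = exp (-3) := by rw [← exp_nsmul, ← exp_add]; norm_num
        _ ≤ exp (-2) := by rw [exp_le_exp]; norm_num
    have h3 : v (3 * β) ≤ exp (-2) := by
      rw [map_mul]
      calc v 3 * v β ≤ exp (-1) * exp (-1) := mul_le_mul' hv3 hβle'
        _ = exp (-2) := by rw [← exp_add]; norm_num
    have hle : v (a - 1) ≤ exp (-2) := by
      rw [hkey, show β * (β ^ 2 + 3 * β + 3) = β ^ 3 + 3 * β ^ 2 + 3 * β by ring]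
      refine le_trans (v.map_add _ _) (max_le ?_ h3)
      exact le_trans (v.map_add _ _) (max_le h1 h2)
    rw [ha, exp_le_exp] at hle
    norm_num at hle

end Summit.BirchSwinnertonDyer.Rank1Residual.X11b.KummerRadical
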